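import Summits.MatrixMultiplication.OmegaCensus.SmallFormats.MatMul22nF3LemmaA
import Summits.MatrixMultiplication.OmegaCensus.SmallFormats.MatMul22nF3LineLemmas
import Summits.MatrixMultiplication.OmegaCensus.SmallFormats.MatMul22nGramNondeg
import Summits.MatrixMultiplication.OmegaCensus.SmallFormats.MatMul22nRowSubcomp
import HarnessLib

/-!
# ω-census family (a): coefficient matrices at PAIR cells are invertible (`𝔽₃`) — the Lemma-A feeders for the `Q`-entry lemmas

Cell `pub-omega` (unit `pub-omega-tensor`, gen 40), topic `Summits/MatrixMultiplication/OmegaCensus` (sub-folder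
`SmallFormats`). Framing (verbatim): lottery ticket; floor = certified bounds/negative ranges. HONEST FRAMING: M1-LEAN-BLUEPRINT F6 glue (last piece): from the
structure data of a row (null lines `L`, maximality, cheapness of the column planes) the coefficient matrix `A` of a term at a PAIR column `a` (`L a = L bb`, the
other two columns on two further distinct lines) w.r.t. the row plane `c` is invertible (`InvertibleAtPairs.det_ne_zero_row`, via `F3Lines.lemmaA_det_ne_zero`);
the column dual (`det_ne_zero_col`) through the transpose-dual computation. These discharge the `det ≠ 0` hypotheses of `PairingCR/RR/CC`. Nothing on `ω`.
-/

namespace Summit.MatrixMultiplication.OmegaCensus.SmallFormats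

open Finset Matrix
open Literature.Computability.AlgebraicComplexity
open Summit.MatrixMultiplication.OmegaCensus.RankOnePlaneCapGeneral

namespace InvertibleAtPairs

variable {ι : Type*} [Fintype ι] {n : ℕ}

/-- **Row version.** `t` a term of the row with Y-form rows `∑ A κ l • c l`, cheap for the columns `j ≠ a` (planes `b j`), seeing the cheap inputs of its own
column `a`; null lines `L` with maximality; `a, bb` a pair and `cc, dd` the other columns with `L a, L cc, L dd` pairwise distinct ⇒ `det A ≠ 0`. -/
theorem det_ne_zero_row (β : BilinComp (mulBilin (ZMod 3) 2 2 n) ι) (c : Fin 2 → (Fin n → ZMod 3)) (b : Fin 4 → Fin 2 → (Fin n → ZMod 3))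
    (L : Fin 4 → Fin 4) (hL1 : ∀ j m, (∑ l, (![![1, 0], ![0, 1], ![1, 1], ![1, 2]] : Fin 4 → Fin 2 → ZMod 3) (L j) l • c l) ⬝ᵥ b j m = 0)
    (hL2 : ∀ j (x : Fin 2 → ZMod 3), (∀ m, (∑ l, x l • c l) ⬝ᵥ b j m = 0) → (x 0 * ((![![1, 0], ![0, 1], ![1, 1], ![1, 2]] : Fin 4 → Fin 2 → ZMod 3) (L j)) 1 - x 1 * ((![![1, 0], ![0, 1], ![1, 1], ![1, 2]] : Fin 4 → Fin 2 → ZMod 3) (L j)) 0) = 0)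
    (t : ι) (A : Matrix (Fin 2) (Fin 2) (ZMod 3)) (hA : ∀ κ, (fun jj => β.g t (Matrix.single κ jj (1 : ZMod 3))) = ∑ l, A κ l • c l)
    (a bb cc dd : Fin 4) (hab : a ≠ bb) (hac : a ≠ cc) (had : a ≠ dd) (hbc : bb ≠ cc) (hbd : bb ≠ dd) (hcd : cc ≠ dd)
    (hLab : L a = L bb) (hLac : L a ≠ L cc) (hLad : L a ≠ L dd) (hLcd : L cc ≠ L dd)
    (hcheap : ∀ j, j ≠ a → ∀ m, β.g t (Matrix.vecMulVec (![-((![![1, 0], ![0, 1], ![1, 1], ![1, 2]] : Fin 4 → Fin 2 → ZMod 3) j 1), (![![1, 0], ![0, 1], ![1, 1], ![1, 2]] : Fin 4 → Fin 2 → ZMod 3) j 0] : Fin 2 → ZMod 3) (b j m)) = 0)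
    (hsees : ∃ m, β.g t (Matrix.vecMulVec (![-((![![1, 0], ![0, 1], ![1, 1], ![1, 2]] : Fin 4 → Fin 2 → ZMod 3) a 1), (![![1, 0], ![0, 1], ![1, 1], ![1, 2]] : Fin 4 → Fin 2 → ZMod 3) a 0] : Fin 2 → ZMod 3) (b a m)) ≠ 0) : A.det ≠ 0 := by
  classical
  -- pairings through A
  have hval : ∀ j m, β.g t (Matrix.vecMulVec (![-((![![1, 0], ![0, 1], ![1, 1], ![1, 2]] : Fin 4 → Fin 2 → ZMod 3) j 1), (![![1, 0], ![0, 1], ![1, 1], ![1, 2]] : Fin 4 → Fin 2 → ZMod 3) j 0] : Fin 2 → ZMod 3) (b j m)) = (∑ l, Matrix.vecMul (![-((![![1, 0], ![0, 1], ![1, 1], ![1, 2]] : Fin 4 → Fin 2 → ZMod 3) j 1), (![![1, 0], ![0, 1], ![1, 1], ![1, 2]] : Fin 4 → Fin 2 → ZMod 3) j 0] : Fin 2 → ZMod 3) A l • c l) ⬝ᵥ b j m := by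
    intro j m; rw [GramNondeg.g_cheapInput_eq_vecMul β t c (b j) _ A hA m, GramNondeg.combo_dotProduct_eq_vecMul]
  have hcross : ∀ j, j ≠ a → ((Matrix.vecMul (![-((![![1, 0], ![0, 1], ![1, 1], ![1, 2]] : Fin 4 → Fin 2 → ZMod 3) j 1), (![![1, 0], ![0, 1], ![1, 1], ![1, 2]] : Fin 4 → Fin 2 → ZMod 3) j 0] : Fin 2 → ZMod 3) A) 0 * ((![![1, 0], ![0, 1], ![1, 1], ![1, 2]] : Fin 4 → Fin 2 → ZMod 3) (L j)) 1 - (Matrix.vecMul (![-((![![1, 0], ![0, 1], ![1, 1], ![1, 2]] : Fin 4 → Fin 2 → ZMod 3) j 1), (![![1, 0], ![0, 1], ![1, 1], ![1, 2]] : Fin 4 → Fin 2 → ZMod 3) j 0] : Fin 2 → ZMod 3) A) 1 * ((![![1, 0], ![0, 1], ![1, 1], ![1, 2]] : Fin 4 → Fin 2 → ZMod 3) (L j)) 0) = 0 := by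
    intro j hj
    exact hL2 j _ fun m => by rw [← hval j m]; exact hcheap j hj m
  have hown : ((Matrix.vecMul (![-((![![1, 0], ![0, 1], ![1, 1], ![1, 2]] : Fin 4 → Fin 2 → ZMod 3) a 1), (![![1, 0], ![0, 1], ![1, 1], ![1, 2]] : Fin 4 → Fin 2 → ZMod 3) a 0] : Fin 2 → ZMod 3) A) 0 * ((![![1, 0], ![0, 1], ![1, 1], ![1, 2]] : Fin 4 → Fin 2 → ZMod 3) (L a)) 1 - (Matrix.vecMul (![-((![![1, 0], ![0, 1], ![1, 1], ![1, 2]] : Fin 4 → Fin 2 → ZMod 3) a 1), (![![1, 0], ![0, 1], ![1, 1], ![1, 2]] : Fin 4 → Fin 2 → ZMod 3) a 0] : Fin 2 → ZMod 3) A) 1 * ((![![1, 0], ![0, 1], ![1, 1], ![1, 2]] : Fin 4 → Fin 2 → ZMod 3) (L a)) 0) ≠ 0 := by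
    intro h0
    obtain ⟨m, hm⟩ := hsees
    apply hm
    rw [hval a m]
    rcases (F3Lines.cross_rep_eq_zero_iff _ (L a)).mp h0 with h | h | h
    · rw [h]; simp
    · rw [h]; exact hL1 a m
    · rw [h]
      have : (∑ l, (-(![![1, 0], ![0, 1], ![1, 1], ![1, 2]] : Fin 4 → Fin 2 → ZMod 3) (L a)) l • c l) = -(∑ l, (![![1, 0], ![0, 1], ![1, 1], ![1, 2]] : Fin 4 → Fin 2 → ZMod 3) (L a) l • c l) := by
        rw [← Finset.sum_neg_distrib]; exact Finset.sum_congr rfl fun l _ => by simp [neg_smul]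
      rw [this, neg_dotProduct, hL1 a m, neg_zero]
  have hb' := hcross bb hab.symm
  rw [← hLab] at hb'
  exact F3Lines.lemmaA_det_ne_zero a bb cc dd hab hac had hbc hbd hcd (L a) (L cc) (L dd) hLac hLad hLcd A hb' (hcross cc hac.symm)
    (hcross dd had.symm) hown

/-- **Column version** (dual): `s` a term of the column with `W_s` rows `∑ Ω κ l • b l`, w-cheap for the rows `i ≠ a` (planes `c i`), seeing the cheap outputs
of its own row `a`; null lines `L'` of the column with maximality; `a, bb` the column's pair, `cc, dd` the other rows on distinct lines ⇒ `det Ω ≠ 0`. -/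
theorem det_ne_zero_col (β : BilinComp (mulBilin (ZMod 3) 2 2 n) ι) (b : Fin 2 → (Fin n → ZMod 3)) (c : Fin 4 → Fin 2 → (Fin n → ZMod 3))
    (L' : Fin 4 → Fin 4) (hL1 : ∀ i m, (∑ l, (![![1, 0], ![0, 1], ![1, 1], ![1, 2]] : Fin 4 → Fin 2 → ZMod 3) (L' i) l • b l) ⬝ᵥ c i m = 0)
    (hL2 : ∀ i (y : Fin 2 → ZMod 3), (∀ m, (∑ l, y l • b l) ⬝ᵥ c i m = 0) → (y 0 * ((![![1, 0], ![0, 1], ![1, 1], ![1, 2]] : Fin 4 → Fin 2 → ZMod 3) (L' i)) 1 - y 1 * ((![![1, 0], ![0, 1], ![1, 1], ![1, 2]] : Fin 4 → Fin 2 → ZMod 3) (L' i)) 0) = 0)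
    (s : ι) (Ω : Matrix (Fin 2) (Fin 2) (ZMod 3)) (hΩ : ∀ κ, β.w s κ = ∑ l, Ω κ l • b l)
    (a bb cc dd : Fin 4) (hab : a ≠ bb) (hac : a ≠ cc) (had : a ≠ dd) (hbc : bb ≠ cc) (hbd : bb ≠ dd) (hcd : cc ≠ dd)
    (hLab : L' a = L' bb) (hLac : L' a ≠ L' cc) (hLad : L' a ≠ L' dd) (hLcd : L' cc ≠ L' dd)
    (hcheap : ∀ i, i ≠ a → ∀ m, ∑ i', c i m i' * (Matrix.vecMul (![-((![![1, 0], ![0, 1], ![1, 1], ![1, 2]] : Fin 4 → Fin 2 → ZMod 3) i 1), (![![1, 0], ![0, 1], ![1, 1], ![1, 2]] : Fin 4 → Fin 2 → ZMod 3) i 0] : Fin 2 → ZMod 3) (β.w s)) i' = 0)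
    (hsees : ∃ m, ∑ i', c a m i' * (Matrix.vecMul (![-((![![1, 0], ![0, 1], ![1, 1], ![1, 2]] : Fin 4 → Fin 2 → ZMod 3) a 1), (![![1, 0], ![0, 1], ![1, 1], ![1, 2]] : Fin 4 → Fin 2 → ZMod 3) a 0] : Fin 2 → ZMod 3) (β.w s)) i' ≠ 0) : Ω.det ≠ 0 := by
  classical
  obtain ⟨β', -, hg, -⟩ := exists_transposeDual' β
  have hrows' : ∀ κ, (fun jj => β'.g s (Matrix.single κ jj (1 : ZMod 3))) = β.w s κ := by
    intro κ; funext jj; rw [hg, CheapSpans.sum_w_mul_single]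
  have hA' : ∀ κ, (fun jj => β'.g s (Matrix.single κ jj (1 : ZMod 3))) = ∑ l, Ω κ l • b l := fun κ => by rw [hrows']; exact hΩ κ
  have hpair : ∀ i m, β'.g s (Matrix.vecMulVec (![-((![![1, 0], ![0, 1], ![1, 1], ![1, 2]] : Fin 4 → Fin 2 → ZMod 3) i 1), (![![1, 0], ![0, 1], ![1, 1], ![1, 2]] : Fin 4 → Fin 2 → ZMod 3) i 0] : Fin 2 → ZMod 3) (c i m)) = ∑ i', c i m i' * (Matrix.vecMul (![-((![![1, 0], ![0, 1], ![1, 1], ![1, 2]] : Fin 4 → Fin 2 → ZMod 3) i 1), (![![1, 0], ![0, 1], ![1, 1], ![1, 2]] : Fin 4 → Fin 2 → ZMod 3) i 0] : Fin 2 → ZMod 3) (β.w s)) i' := by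
    intro i m; rw [hg, RowSubcomp.pairing_eq]
  refine det_ne_zero_row β' b c L' hL1 hL2 s Ω hA' a bb cc dd hab hac had hbc hbd hcd hLab hLac hLad hLcd ?_ ?_
  · intro i hi m; rw [hpair]; exact hcheap i hi m
  · obtain ⟨m, hm⟩ := hsees; exact ⟨m, by rw [hpair]; exact hm⟩

end InvertibleAtPairs

end Summit.MatrixMultiplication.OmegaCensus.SmallFormats
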